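import Summits.BirchSwinnertonDyer.BirchSwinnertonDyer.Theorems.ClassRecordThreeEulerHalvesAtThreeWalkOrders
import Summits.BirchSwinnertonDyer.BirchSwinnertonDyer.Theorems.ClassRecordThreeEulerHalvesAtThreeWalkTildeClass
import Summits.BirchSwinnertonDyer.Rank1Residual.X11b.RingClassFieldNoTorsionOfIrreducible
import Summits.BirchSwinnertonDyer.Rank1Residual.X11b.SplitPrimeUnramified
import Literature.NumberTheory.EllipticCurves.WeilPairingProofs
import HarnessLib

/-!
# Route `ErratumRoadFive` (rung K2), crux child `NonSurjCornerKolyJ` (item stmt-BirchSwinnertonDyer-19947), registered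
# stub `stub_kolyJ_max` (Jetchev's MAX form at `p ∥ N` on corner frames): the walk's S7 input `hordκ` ON THE
# IRREDUCIBLE NON-SURJECTIVE CELL — `p^{k−j} ∣ ord c_k(m) ⟹ ord_p(P_m) ≤ j` WITHOUT `ρ̄_{E,p}` onto
# (cell `bsd-stepL`, seat `bsd-stepL-corner-p1` g7; `--supports stmt-BirchSwinnertonDyer-19947`)

WHAT. tam3-p1's instantiated §6 walk (`Koly.tamagawaExponent_le_m_of_rowFamilies` ∕ `…_of_admissibleFamilies`,
`Theorems/ClassRecordThreeEulerHalvesAtThreeWalkFamilies[Adm].lean`; `p`-generic, carrier-blind) is the kernel road to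
`stub_kolyJ_max` (and to 19109's `stub_jetchevMaxHLAtThree`). Its S7 input `hordκ` was DISCHARGED by tam3
(`…WalkOrders.lean`: `divOrd_le_of_pow_dvd_addOrderOf_kolyvaginClass`, `hordκ_of_rowData`, `hordκ_of_admissibleData`)
under `ρ̄_{E,p}` ONTO — used in exactly one place, the admissibility of `E(K[m]) ⊆ E(K̄)` modulo `p^k` (Gross 1991
Lemma 4.3 via `RingClassNoTorsion.isAdmissible_pointsSubgroup`). On the (T4′) corner `ρ̄` is NOT onto; this file is the
verbatim twin with that one input replaced by x11b3-p4's IRREDUCIBLE admissibility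
`NoTorsionIrr.isAdmissible_pointsSubgroup_of_hasIrreducibleModPGaloisRep` (Gross L.4.3 without
surjectivity: `E[p]` irreducible, `p` odd, the Weil pairing — a tree THEOREM `exists_weilPairing_holds` —, `p`
unramified in `K` — from `SatisfiesHeegnerHypothesis p K`, i.e. `p` split, `isUnramifiedIn_of_satisfiesHeegnerHypothesis_of_dvd`
—, and `p ∤ m` — automatic: the prime factors of an admissible conductor are Kolyvagin primes, hence `≠ p`).

* §1 `not_dvd_of_forall_isKolyvaginPrime` — `p ∤ m` for a conductor all of whose prime factors are Zhang–Kolyvagin primes.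
* §2 `divOrd_le_of_pow_dvd_addOrderOf_kolyvaginClass_of_irreducible`, `hordκ_of_rowData_of_irreducible`,
  `hordκ_of_admissibleData_of_irreducible` — tam3's three theorems with `(hρ : Surj)` ↦ `(hirr : Irr) (hHp : p splits in K)`.
* §3 `exists_tildeClass_of_exactDepth_of_irreducible`, `hκt_of_tildeSelmer_of_irreducible` — the ALGEBRAIC half of S7♯
  (`κ = p^u • κ̃`, `ord κ̃ = p^k`; tam3 `…WalkTildeClass`) with the same replacement.

So the corner walk's Galois-image delta w.r.t. 19109's is now: S7 `hordκ` ✓ and S7♯ algebraic half ✓ (this file);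
Lemma 6.1 (`…WalkCebotarev`, keyed on `Surj` through
`McCallum1991_cor_3_2_pow_shift_of_chebotarev`) — for the corner images the Čebotarev step needs shim3b g4's
`McCallum1991_cor_3_2_pow_of_irr_of_neg` (ANY odd `p`, `E[p]` irreducible with `−1 ∈ ρ̄(Γ_ℚ)`: true for 5S4, N(C_s)(5),
N(C_s)(7), N(C_ns)(7)) in SHIFT form — not in the tree; and Prop. 4.9 at `v ∣ p` (CORNER-G7.md §1) inside `h49`.
HONEST FRAMING: six theorems (no definition, no named fact, no `sorry`); `stub_kolyJ_max` is NOT discharged; nothing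
asserted about any curve; no item closes; BSD not advanced (T7).

References: [Jetchev2008] §3.1 items 4–5 (p. 817); [McCallumLMS1991] §4 (4)–(5), Cor. 4.5; [GrossLMS1991] Prop. 3.6,
Lemma 4.3; [Cox2013] §9.A; tree: tam3-p1 p497091 (`…WalkOrders`), x11b3-p4 `X11b/RingClassFieldNoTorsionOfIrreducible.lean`.
-/

set_option autoImplicit false
set_option linter.dupNamespace false

noncomputable section

open scoped Classical NumberField

namespace Summit.BirchSwinnertonDyer.Rank1Residual.X11b.Three.Koly

open WeierstrassCurve IsDedekindDomain NumberField Field Literature.NumberTheory.EllipticCurves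
  Literature.NumberTheory.EllipticCurves.ModularForms Literature.NumberTheory.EllipticCurves.KolyvaginCocycle
  Literature.NumberTheory.EllipticCurves.Jetchev2008 Literature.NumberTheory.GaloisRepresentations
  Summit.BirchSwinnertonDyer.Rank1Residual.X11b Summit.BirchSwinnertonDyer.Rank1Residual.JET

variable {K : Type} [Field K] [NumberField K] (W : WeierstrassCurve ℚ) [W.IsElliptic] [W.IsGloballyMinimal]
  [NeZero (W.conductorNorm ℤ)]

/-! ### §1 Admissible conductors are prime to `p` -/

omit [W.IsElliptic] [NeZero (W.conductorNorm ℤ)] in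
/-- **`p ∤ m` for a conductor all of whose prime factors are Zhang–Kolyvagin primes** (each is `≠ p` by
definition, `Zhang2014.IsKolyvaginPrime`: `ℓ ∤ N D p`). [cite: WZhang2014, Notations (xii)] -/
theorem not_dvd_of_forall_isKolyvaginPrime {N : ℕ} {p : ℕ} [Fact p.Prime] {m : ℕ} (hm : m ≠ 0)
    (hkol : ∀ q ∈ m.primeFactors, Zhang2014.IsKolyvaginPrime N W K p q) : ¬ p ∣ m := by
  intro hpm
  have hmem : p ∈ m.primeFactors := Nat.mem_primeFactors.mpr ⟨Fact.out, hpm, hm⟩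
  exact (hkol p hmem).2.2.2.1 rfl

/-! ### §2 `hordκ` on the irreducible cell -/

/-- **`p^{k−j} ∣ ord c_k(m)` with `j < k` forces `ord_p(P_m) ≤ j` — IRREDUCIBLE image.** tam3-p1's
`divOrd_le_of_pow_dvd_addOrderOf_kolyvaginClass` verbatim with the admissibility input taken from
`NoTorsionIrr.isAdmissible_pointsSubgroup_of_hasIrreducibleModPGaloisRep` (`E[p]` irreducible,
`p` odd, Weil pairing by `exists_weilPairing_holds`, `p` split in `K`, `p ∤ m` by §1). Frame: `K` imaginary quadratic,
`(N_E, d_K) = 1`, `d_K < −4`. [cite: Jetchev2008, §3.1 items 4–5 (p. 817)] [cite: McCallumLMS1991, Cor. 4.5, §5 (p. 305)]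
[cite: GrossLMS1991, §4 Lemma 4.3] -/
theorem divOrd_le_of_pow_dvd_addOrderOf_kolyvaginClass_of_irreducible (hK : IsImaginaryQuadratic K)
    (hND : IsCoprime ((W.conductorNorm ℤ : ℕ) : ℤ) (NumberField.discr K)) (hD : NumberField.discr K < -4)
    {p : ℕ} [Fact p.Prime] (hp2 : p ≠ 2) (hirr : W.HasIrreducibleModPGaloisRep p)
    (hHp : SatisfiesHeegnerHypothesis p K)
    (Dt : ModularParametrizationData W (W.conductorNorm ℤ)) (β : ℤ) (ι : K →+* ℂ)
    (D : ∀ m : ℕ, KolyvaginHeegnerData Dt β ι m) {k : ℕ} {m : ℕ} (hm : Squarefree m)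
    (hkol : ∀ q ∈ m.primeFactors,
      Zhang2014.IsKolyvaginPrime (W.conductorNorm ℤ) W K p q ∧ k ≤ Zhang2014.kolyvaginIndex W p q)
    {j : ℕ} (hj : j < k)
    (hdvd : p ^ (k - j) ∣ addOrderOf ((D m).kolyvaginClass (Fact.out : p.Prime) k :
      galoisCohomology ((W.baseChange K).torsionGaloisModule ((p ^ k : ℕ) : ℤ)) 1)) :
    divOrd (D m) p ≤ (j : ℕ∞) := by
  have hp : p.Prime := Fact.out
  by_contra hlt
  rw [not_le] at hlt
  -- `p^{j+1} ∣ P_m`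
  have hle : ((j + 1 : ℕ) : ℕ∞) ≤ divOrd (D m) p := Order.add_one_le_of_lt (by exact_mod_cast hlt)
  obtain ⟨Q, hQ⟩ := pDiv_of_le_divOrd (D m) p (j + 1) hle
  -- the two standing inputs, the first on the IRREDUCIBLE cell
  have hA := NoTorsionIrr.isAdmissible_pointsSubgroup_of_hasIrreducibleModPGaloisRep (D m) hK
    hm.ne_zero hp hp2 hirr (WeierstrassCurve.exists_weilPairing_holds W p)
    (isUnramifiedIn_of_satisfiesHeegnerHypothesis_of_dvd hK hHp hp dvd_rfl)
    (not_dvd_of_forall_isKolyvaginPrime W hm.ne_zero fun q hq ↦ (hkol q hq).1) k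
  have hP := KolyCert.toGeomPoints_derivedPoint_mem_invPoints_of_dvd_zhang hK ι Dt hp hND hD hm hkol
    (fun m' _ ↦ D m') m dvd_rfl
  -- `p^{k-j-1} • c_k(m) = 0`
  have hzero : ((p ^ (k - j - 1) : ℕ) : ℤ) • (D m).kolyvaginClass hp k = 0 := by
    rw [zsmul_kolyvaginClass_eq_zero_iff (D m) hp k hA hP]
    refine ⟨Q, ?_⟩
    have hkj : k - j - 1 + (j + 1) = k := by omega
    rw [← hQ, smul_smul, ← Nat.cast_mul, ← pow_add, hkj]
  -- hence `ord c_k(m) ∣ p^{k-j-1}`, contradicting `p^{k-j} ∣ ord c_k(m)`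
  have hord : addOrderOf ((D m).kolyvaginClass hp k) ∣ p ^ (k - j - 1) := by
    apply addOrderOf_dvd_of_nsmul_eq_zero
    rw [← natCast_zsmul]
    exact_mod_cast hzero
  have h1 : p ^ (k - j) ∣ p ^ (k - j - 1) := dvd_trans hdvd hord
  have h2 : k - j ≤ k - j - 1 := (Nat.pow_dvd_pow_iff_le_right hp.one_lt).mp h1
  omega

/-- **The hypothesis `hordκ` of `Koly.tamagawaExponent_le_m_of_rowFamilies` (p496626), VERBATIM, for a total data system
— IRREDUCIBLE image** (frame: `(N_E, d_K) = 1`, `d_K < −4`, `p` odd split in `K`, `E[p]` irreducible).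
[cite: Jetchev2008, §3.1 items 4–5 (p. 817)] [cite: McCallumLMS1991, Cor. 4.5] -/
theorem hordκ_of_rowData_of_irreducible (hK : IsImaginaryQuadratic K)
    (hND : IsCoprime ((W.conductorNorm ℤ : ℕ) : ℤ) (NumberField.discr K)) (hD : NumberField.discr K < -4)
    {p : ℕ} [Fact p.Prime] (hp2 : p ≠ 2) (hirr : W.HasIrreducibleModPGaloisRep p)
    (hHp : SatisfiesHeegnerHypothesis p K)
    (Dt : ModularParametrizationData W (W.conductorNorm ℤ)) (β : ℤ) (ι : K →+* ℂ)
    (D : ∀ m : ℕ, KolyvaginHeegnerData Dt β ι m) (k c : ℕ) :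
    ∀ (m : ℕ), c ∣ m → Squarefree m →
      (∀ q ∈ m.primeFactors, Zhang2014.IsKolyvaginPrime (W.conductorNorm ℤ) W K p q ∧
        k ≤ Zhang2014.kolyvaginIndex W p q) →
      ∀ j : ℕ, j < k →
        p ^ (k - j) ∣ addOrderOf ((D m).kolyvaginClass (Fact.out : p.Prime) k :
          galoisCohomology ((W.baseChange K).torsionGaloisModule ((p ^ k : ℕ) : ℤ)) 1) →
        divOrd (D m) p ≤ (j : ℕ∞) :=
  fun _ _ hm hkol _ hj hdvd ↦
    divOrd_le_of_pow_dvd_addOrderOf_kolyvaginClass_of_irreducible W hK hND hD hp2 hirr hHp Dt β ι D hm hkol hj hdvd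

/-- **The same for data on the ADMISSIBLE-conductor subtype** (the `hordκ` hypothesis of
`Koly.tamagawaExponent_le_m_of_admissibleFamilies`, VERBATIM) — IRREDUCIBLE image.
[cite: Jetchev2008, §3.1 items 4–5 (p. 817)] [cite: McCallumLMS1991, Cor. 4.5, §5 (p. 305)] -/
theorem hordκ_of_admissibleData_of_irreducible (hK : IsImaginaryQuadratic K)
    (hND : IsCoprime ((W.conductorNorm ℤ : ℕ) : ℤ) (NumberField.discr K)) (hD : NumberField.discr K < -4)
    {p : ℕ} [Fact p.Prime] (hp2 : p ≠ 2) (hirr : W.HasIrreducibleModPGaloisRep p)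
    (hHp : SatisfiesHeegnerHypothesis p K)
    (Dt : ModularParametrizationData W (W.conductorNorm ℤ)) (β : ℤ) (ι : K →+* ℂ) (k : ℕ)
    (D : ∀ s : {m : ℕ // Squarefree m ∧ ∀ q ∈ m.primeFactors,
        Zhang2014.IsKolyvaginPrime (W.conductorNorm ℤ) W K p q ∧ k ≤ Zhang2014.kolyvaginIndex W p q},
      KolyvaginHeegnerData Dt β ι s.1) :
    ∀ s (j : ℕ), j < k →
      p ^ (k - j) ∣ addOrderOf ((D s).kolyvaginClass (Fact.out : p.Prime) k :
        galoisCohomology ((W.baseChange K).torsionGaloisModule ((p ^ k : ℕ) : ℤ)) 1) →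
      divOrd (D s) p ≤ (j : ℕ∞) := by
  intro s j hj hdvd
  have hp : p.Prime := Fact.out
  -- data at every divisor of `s`, from `D` (divisors of admissible conductors are admissible)
  have hdiv : ∀ m : ℕ, m ∣ s.1 → Squarefree m ∧ ∀ q ∈ m.primeFactors,
      Zhang2014.IsKolyvaginPrime (W.conductorNorm ℤ) W K p q ∧ k ≤ Zhang2014.kolyvaginIndex W p q :=
    fun m hm ↦ ⟨s.2.1.squarefree_of_dvd hm, fun q hq ↦
      s.2.2 q (Nat.primeFactors_mono hm s.2.1.ne_zero hq)⟩
  by_contra hlt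
  rw [not_le] at hlt
  have hle : ((j + 1 : ℕ) : ℕ∞) ≤ divOrd (D s) p := Order.add_one_le_of_lt (by exact_mod_cast hlt)
  obtain ⟨Q, hQ⟩ := pDiv_of_le_divOrd (D s) p (j + 1) hle
  have hA := NoTorsionIrr.isAdmissible_pointsSubgroup_of_hasIrreducibleModPGaloisRep (D s) hK
    s.2.1.ne_zero hp hp2 hirr (WeierstrassCurve.exists_weilPairing_holds W p)
    (isUnramifiedIn_of_satisfiesHeegnerHypothesis_of_dvd hK hHp hp dvd_rfl)
    (not_dvd_of_forall_isKolyvaginPrime W s.2.1.ne_zero fun q hq ↦ (s.2.2 q hq).1) k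
  have hP := KolyCert.toGeomPoints_derivedPoint_mem_invPoints_of_dvd_zhang hK ι Dt hp hND hD s.2.1 s.2.2
    (fun m hm ↦ D ⟨m, hdiv m hm⟩) s.1 dvd_rfl
  have hzero : ((p ^ (k - j - 1) : ℕ) : ℤ) • (D s).kolyvaginClass hp k = 0 := by
    rw [zsmul_kolyvaginClass_eq_zero_iff (D s) hp k hA hP]
    refine ⟨Q, ?_⟩
    have hkj : k - j - 1 + (j + 1) = k := by omega
    rw [← hQ, smul_smul, ← Nat.cast_mul, ← pow_add, hkj]
  have hord : addOrderOf ((D s).kolyvaginClass hp k) ∣ p ^ (k - j - 1) := by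
    apply addOrderOf_dvd_of_nsmul_eq_zero
    rw [← natCast_zsmul]
    exact_mod_cast hzero
  have h1 : p ^ (k - j) ∣ p ^ (k - j - 1) := dvd_trans hdvd hord
  have h2 : k - j ≤ k - j - 1 := (Nat.pow_dvd_pow_iff_le_right hp.one_lt).mp h1
  omega

/-! ### §3 S7♯ (algebraic half) on the irreducible cell -/

section Tilde

variable {W}
variable {N : ℕ} [NeZero N] {Dt : ModularParametrizationData W N} {β : ℤ} {ι : K →+* ℂ} {n : ℕ}

omit [NeZero (W.conductorNorm ℤ)] in
/-- **`κ̃` with `κ = p^u • κ̃`, `ord κ̃ = p^k` — IRREDUCIBLE image.** tam3-p1's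
`exists_tildeClass_of_exactDepth_of_surj` verbatim with the admissibility for `p^{k+u}` taken from
`NoTorsionIrr.isAdmissible_pointsSubgroup_of_hasIrreducibleModPGaloisRep` (`E[p]` irreducible, `p` odd split in `K`,
Weil pairing by `exists_weilPairing_holds`, `p ∤ n` by §1). [cite: Jetchev2008, §3.1 item 7 (p. 817)]
[cite: McCallumLMS1991, §4 (4)–(6)] [cite: GrossLMS1991, Prop. 3.6, Lemma 4.3] -/
theorem exists_tildeClass_of_exactDepth_of_irreducible
    (hK : IsImaginaryQuadratic K) (hND : IsCoprime (N : ℤ) (NumberField.discr K))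
    (hD : NumberField.discr K < -4) {p : ℕ} (hp : p.Prime) (hp2 : p ≠ 2)
    (hirr : W.HasIrreducibleModPGaloisRep p) (hHp : SatisfiesHeegnerHypothesis p K)
    {k u : ℕ} (hk : 1 ≤ k) (hn : Squarefree n)
    (hkol : ∀ q ∈ n.primeFactors,
      Zhang2014.IsKolyvaginPrime N W K p q ∧ k + u ≤ Zhang2014.kolyvaginIndex W p q)
    (data : (m : ℕ) → m ∣ n → KolyvaginHeegnerData Dt β ι m)
    (hdvd : ∃ Q : (W.baseChange (ringClassField K ι n)).toAffine.Point,
      ((p ^ u : ℕ) : ℤ) • Q = (data n dvd_rfl).derivedPoint)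
    (hndvd : ¬ ∃ Q : (W.baseChange (ringClassField K ι n)).toAffine.Point,
      ((p ^ (u + 1) : ℕ) : ℤ) • Q = (data n dvd_rfl).derivedPoint) :
    ∃ (hAk : IsAdmissible (absoluteGaloisGroup K) (data n dvd_rfl).pointsSubgroup ((p ^ k : ℕ) : ℤ))
      (Q : (W.baseChange (ringClassField K ι n)).toAffine.Point)
      (hQ : (data n dvd_rfl).toGeomPoints Q ∈
        invPoints (absoluteGaloisGroup K) (data n dvd_rfl).pointsSubgroup ((p ^ k : ℕ) : ℤ)),
      ((p ^ u : ℕ) : ℤ) • Q = (data n dvd_rfl).derivedPoint ∧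
      addOrderOf (kolyvaginClass (W.baseChange K) ((p ^ k : ℕ) : ℤ)
        ((W.baseChange K).zsmul_geomPoints_surjective_of_charZero
          (by exact_mod_cast pow_ne_zero k hp.ne_zero)) hAk ((data n dvd_rfl).toGeomPoints Q) hQ) =
        p ^ k ∧
      (data n dvd_rfl).kolyvaginClass hp k = ((p ^ u : ℕ) : ℤ) •
        kolyvaginClass (W.baseChange K) ((p ^ k : ℕ) : ℤ)
          ((W.baseChange K).zsmul_geomPoints_surjective_of_charZero
            (by exact_mod_cast pow_ne_zero k hp.ne_zero)) hAk ((data n dvd_rfl).toGeomPoints Q) hQ := by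
  haveI : Fact p.Prime := ⟨hp⟩
  exact exists_tildeClass_of_exactDepth _ hp hk
    (NoTorsionIrr.isAdmissible_pointsSubgroup_of_hasIrreducibleModPGaloisRep _ hK hn.ne_zero hp hp2 hirr
      (WeierstrassCurve.exists_weilPairing_holds W p)
      (isUnramifiedIn_of_satisfiesHeegnerHypothesis_of_dvd hK hHp hp dvd_rfl)
      (not_dvd_of_forall_isKolyvaginPrime (K := K) W hn.ne_zero fun q hq ↦ (hkol q hq).1) (k + u))
    (KolyCert.toGeomPoints_derivedPoint_mem_invPoints_of_dvd_zhang hK ι Dt hp hND hD hn hkol data n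
      dvd_rfl)
    hdvd hndvd

end Tilde

/-- **The walk's `hκt` from the Selmer membership of the classes of the `p^u`-th roots — IRREDUCIBLE image.**
tam3-p1's `hκt_of_tildeSelmer` verbatim with `(hρ : Surj) ↦ (hirr : Irr) (hHp : p splits in K)`; the Selmer
membership `hsel` stays a NAMED hypothesis ([J] Prop. 4.5–4.6 + Gross Prop. 5.4 for the class of `Q`).
[cite: Jetchev2008, §3.1 item 7 (p. 817), Prop. 4.5–4.6 (pp. 819–820)] [cite: GrossLMS1991, Prop. 5.4] -/
theorem hκt_of_tildeSelmer_of_irreducible (hK : IsImaginaryQuadratic K)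
    (hND : IsCoprime ((W.conductorNorm ℤ : ℕ) : ℤ) (NumberField.discr K)) (hD : NumberField.discr K < -4)
    {p : ℕ} [Fact p.Prime] (hp2 : p ≠ 2) (hirr : W.HasIrreducibleModPGaloisRep p)
    (hHp : SatisfiesHeegnerHypothesis p K)
    (Dt : ModularParametrizationData W (W.conductorNorm ℤ)) (β : ℤ) (ι : K →+* ℂ) (τ : K ≃ₐ[ℚ] K)
    {k : ℕ} (hk : 1 ≤ k)
    (𝒯 : Literature.NumberTheory.GaloisRepresentations.DiscreteGaloisModule.SelmerStructure
      ((W.baseChange K).torsionGaloisModule ((p ^ k : ℕ) : ℤ)))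
    (D : ∀ s : {m : ℕ // Squarefree m ∧ ∀ q ∈ m.primeFactors,
        Zhang2014.IsKolyvaginPrime (W.conductorNorm ℤ) W K p q ∧ k ≤ Zhang2014.kolyvaginIndex W p q},
      KolyvaginHeegnerData Dt β ι s.1)
    (eb : ℕ → Bool) (hdivfin : ∀ s, Zhang2014.levelIndex W p s.1 = ⊤ → divOrd (D s) p ≠ ⊤)
    (hsel : ∀ s (u : ℕ) (Q : (W.baseChange (ringClassField K ι s.1)).toAffine.Point)
      (hAk : IsAdmissible (absoluteGaloisGroup K) (D s).pointsSubgroup ((p ^ k : ℕ) : ℤ))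
      (hQ : (D s).toGeomPoints Q ∈ invPoints (absoluteGaloisGroup K) (D s).pointsSubgroup ((p ^ k : ℕ) : ℤ)),
      ((p ^ u : ℕ) : ℤ) • Q = (D s).derivedPoint →
      (¬ ∃ Q' : (W.baseChange (ringClassField K ι s.1)).toAffine.Point,
        ((p ^ (u + 1) : ℕ) : ℤ) • Q' = (D s).derivedPoint) →
      ((u + k : ℕ) : ℕ∞) ≤ Zhang2014.levelIndex W p s.1 →
      (kolyvaginClass (W.baseChange K) ((p ^ k : ℕ) : ℤ)
        ((W.baseChange K).zsmul_geomPoints_surjective_of_charZero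
          (by exact_mod_cast pow_ne_zero k (Fact.out : p.Prime).ne_zero)) hAk ((D s).toGeomPoints Q) hQ :
          galoisCohomology ((W.baseChange K).torsionGaloisModule ((p ^ k : ℕ) : ℤ)) 1) ∈
        signPart W K τ ((p ^ k : ℕ) : ℤ) (if eb s.1 then 1 else -1)
          (selmerF W ((p ^ k : ℕ) : ℤ) 𝒯 (placesDividing K s.1)).selmerGroup) :
    ∀ s, (if divOrd (D s) p < Zhang2014.levelIndex W p s.1 then divOrd (D s) p else (⊤ : ℕ∞)) +
        (k : ℕ∞) ≤ Zhang2014.levelIndex W p s.1 →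
      ∃ x : galoisCohomology ((W.baseChange K).torsionGaloisModule ((p ^ k : ℕ) : ℤ)) 1,
        x ∈ signPart W K τ ((p ^ k : ℕ) : ℤ) (if eb s.1 then 1 else -1)
          (selmerF W ((p ^ k : ℕ) : ℤ) 𝒯 (placesDividing K s.1)).selmerGroup ∧
        addOrderOf x = p ^ k ∧
        ((D s).kolyvaginClass (Fact.out : p.Prime) k :
            galoisCohomology ((W.baseChange K).torsionGaloisModule ((p ^ k : ℕ) : ℤ)) 1) =
          p ^ (if divOrd (D s) p < Zhang2014.levelIndex W p s.1 then divOrd (D s) p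
            else (⊤ : ℕ∞)).toNat • x := by
  have hp : p.Prime := Fact.out
  intro s hs
  by_cases hlt : divOrd (D s) p < Zhang2014.levelIndex W p s.1
  · rw [if_pos hlt] at hs ⊢
    have hne : divOrd (D s) p ≠ ⊤ := ne_top_of_lt hlt
    obtain ⟨u, hu⟩ : ∃ u : ℕ, divOrd (D s) p = u := ⟨_, (ENat.coe_toNat hne).symm⟩
    rw [hu] at hs hlt ⊢
    simp only [ENat.toNat_coe]
    have hdvd : PDiv (D s) p u := pDiv_of_le_divOrd _ _ _ (le_of_eq hu.symm)
    have hndvd : ¬ PDiv (D s) p (u + 1) := fun h ↦ by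
      have h' := le_divOrd_of_pDiv (p := p) (D s) h
      rw [hu] at h'
      exact absurd (by exact_mod_cast h' : u + 1 ≤ u) (by omega)
    have huk : ((u + k : ℕ) : ℕ∞) ≤ Zhang2014.levelIndex W p s.1 := by push_cast; exact hs
    have hkol : ∀ q ∈ s.1.primeFactors,
        Zhang2014.IsKolyvaginPrime (W.conductorNorm ℤ) W K p q ∧ k + u ≤ Zhang2014.kolyvaginIndex W p q :=
      fun q hq ↦ ⟨(s.2.2 q hq).1, by
        rw [Nat.add_comm]; exact Zhang2014.natCast_le_levelIndex_iff.mp huk q hq⟩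
    have hdiv : ∀ m : ℕ, m ∣ s.1 → Squarefree m ∧ ∀ q ∈ m.primeFactors,
        Zhang2014.IsKolyvaginPrime (W.conductorNorm ℤ) W K p q ∧ k ≤ Zhang2014.kolyvaginIndex W p q :=
      fun m hm ↦ ⟨s.2.1.squarefree_of_dvd hm, fun q hq ↦
        s.2.2 q (Nat.primeFactors_mono hm s.2.1.ne_zero hq)⟩
    obtain ⟨hAk, Q, hQ, hQP, hord, hκ⟩ := exists_tildeClass_of_exactDepth_of_irreducible (Dt := Dt) (β := β)
      hK hND hD hp hp2 hirr hHp hk s.2.1 hkol (fun m hm ↦ D ⟨m, hdiv m hm⟩) hdvd hndvd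
    refine ⟨_, hsel s u Q hAk hQ hQP hndvd huk, hord, ?_⟩
    rw [← natCast_zsmul]
    exact hκ
  · rw [if_neg hlt, top_add, top_le_iff] at hs
    exact (hlt (lt_of_lt_of_eq (lt_top_iff_ne_top.mpr (hdivfin s hs)) hs.symm)).elim

end Summit.BirchSwinnertonDyer.Rank1Residual.X11b.Three.Koly

end
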